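import Summits.Ventures.HSemireg.WedgeHankelRecurrenceGaussChebyshevCSGcd

/-!
# Venture HSemireg — **THE MONIC MIXED RESULTANT OVER EVERY COMMUTATIVE RING: `Res_{(m,n)}(C_m, S_n) = 0` IF `(n+1) ∕ gcd(m, n+1)` IS EVEN, AND `= (−1)^{mn∕2} · 2^{gcd(m,n+1) − 1}` OTHERWISE**
# (Vieta–Lucas `C_m` against Vieta–Fibonacci `S_n`) — completing the monic table with N468 (`Res(S_m,S_n) ∈ {0, ±1}`) and N469 (`Res(C_m,C_n) ∈ {0, ±2^{gcd}}`): all the powers of `2` in N464 but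
# `2^{gcd − 1}` were leading coefficients, the survivor being the consecutive value `Res_{(n+1,n)}(C_{n+1}, S_n) = 2^n (−1)^{n(n+1)∕2}` (`C_{n+1} = 2S_{n+1} − X S_n`); four Euclidean steps with the
# monic product formulas of N481

HONEST FRAMING. Part of the Lean index of the computation cell `pub-hsemireg` (seat p10 gen 48, Sunday typer «UNIFORM-IN-n»).  Polynomial ∕ resultant algebra and `ℕ`-parity bookkeeping only; no
variety, no cohomology theory, no sheaf, no Ext group and no semiregularity map is constructed here; nothing here says that HC / HC_CM / HC_AV holds; no Literature fact (unproved `Prop`) is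
declared or used.  Custodian versions as in `WedgeHankelSiegelIdeal` (1/3).
SOURCES (cited).  K. Dilcher, K. B. Stolarsky, Trans. Amer. Math. Soc. 357 (2005) 965–981, §3–§4 (resultants of Chebyshev-type pairs and their Dickson normalisations); R. Lidl, G. L. Mullen, G. Turnwald,
*Dickson Polynomials* (1993), Ch. 2.
PROOF TYPED HERE.  N481 `chebyshevC_mul_S`, `chebyshevC_add_sub_C_sub`; N465 `chebyshevS_natDegree_monic`; N468 `chebyshevS_natDegree_pred_le`, `chebyshevS_resultant_succ`; N469 `chebyshevC_natDegree_le`;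
N464 `even_mul_of_not_even_div`; `Literature…ChebyshevChains.monic_chebyshevC_and_natDegree`; Mathlib `resultant_add_mul_right ∕ _left`, `resultant_add_right_deg ∕ _left_deg`, `resultant_C_mul_right ∕
_left`, `resultant_zero_right`, `resultant_C_zero_left`, `C_eq_S_sub_X_mul_S`, `S_neg`, `S_neg_one`, `C_neg`.
DEDUP DISCLOSURE (`rg -n 'chebyshevCS_resultant' Summits Literature HarnessLib`, 2026-09-04): 0 hits for the 9 names below.

WHAT IS IN THE TREE.  N464 (the `T ∕ U` form), N468, N469, N481.
THIS FILE (namespace `Summit.Ventures.HSemireg.Wedge.HankelOuter` continued; CHAINED on N481; 0 definitions):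
* §1247 `chebyshevCS_resultant_of_S_rel`, `chebyshevCS_resultant_of_C_rel`, **`chebyshevCS_resultant_S_add_two_mul`**, **`chebyshevCS_resultant_S_reflect`**, `chebyshevCS_resultant_S_two_mul_pred`,
  **`chebyshevCS_resultant_C_add_two_mul`**, **`chebyshevCS_resultant_C_reflect`**, `chebyshevCS_resultant_succ_pred`, **`chebyshevCS_resultant_closed`**.
CAVEATS.  `mn ∕ 2` is `ℕ`-division (exact whenever the resultant is non-zero).  Formal degrees explicit.  Nothing Ext-side.  New names only.
-/

open Module Polynomial
open scoped Matrix Polynomial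

namespace Summit.Ventures.HSemireg.Wedge.HankelOuter

/-! ## §1247. `Res(C_m, S_n)` in closed form -/

/-- `S`-side bookkeeping: if `S_N = ε S_j + C_{m+1} S_i` with `i + (m+1) ≤ N = j + k`, then `Res_{(m+1,N)}(C_{m+1}, S_N) = ε^{m+1} Res_{(m+1,j)}(C_{m+1}, S_j)` (monic: no leading-coefficient power).
[this file, §1247] -/
theorem chebyshevCS_resultant_of_S_rel {R : Type*} [CommRing R] [Nontrivial R] {m j i N k : ℕ} {ε : R}
    (hrel : Polynomial.Chebyshev.S R (N : ℤ) = Polynomial.C ε * Polynomial.Chebyshev.S R (j : ℤ) + Polynomial.Chebyshev.C R ((m + 1 : ℕ) : ℤ) * Polynomial.Chebyshev.S R (i : ℤ))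
    (hdeg : i + (m + 1) ≤ N) (hk : N = j + k) :
    (Polynomial.Chebyshev.C R ((m + 1 : ℕ) : ℤ)).resultant (Polynomial.Chebyshev.S R (N : ℤ)) (m + 1) N =
      ε ^ (m + 1) * (Polynomial.Chebyshev.C R ((m + 1 : ℕ) : ℤ)).resultant (Polynomial.Chebyshev.S R (j : ℤ)) (m + 1) j := by
  obtain ⟨hmonic, hdegC⟩ := Literature.Algebra.Polynomial.ChebyshevChains.monic_chebyshevC_and_natDegree (R := R) m
  have hcoeff : (Polynomial.Chebyshev.C R ((m + 1 : ℕ) : ℤ)).coeff (m + 1) = 1 := by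
    have h := hmonic.coeff_natDegree
    rwa [hdegC] at h
  have hf : (Polynomial.Chebyshev.C R ((m + 1 : ℕ) : ℤ)).natDegree ≤ m + 1 := hdegC.le
  have hp : (Polynomial.Chebyshev.S R (i : ℤ)).natDegree + (m + 1) ≤ N := (Nat.add_le_add_right (chebyshevS_natDegree_monic (R := R) i).1.le _).trans hdeg
  have hg : (Polynomial.C ε * Polynomial.Chebyshev.S R (j : ℤ)).natDegree ≤ j :=
    (Polynomial.natDegree_C_mul_le _ _).trans (chebyshevS_natDegree_monic (R := R) j).1.le
  rw [hrel, Polynomial.resultant_add_mul_right _ _ _ _ _ hp hf, hk, Polynomial.resultant_add_right_deg _ _ _ _ k hg, hcoeff, Polynomial.resultant_C_mul_right]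
  ring

/-- `C`-side bookkeeping: if `C_M = C_i + S_u · p` with `deg p + u ≤ M = i + k`, then `Res_{(M,u)}(C_M, S_u) = (−1)^{uk} Res_{(i,u)}(C_i, S_u)`. [this file, §1247] -/
theorem chebyshevCS_resultant_of_C_rel {R : Type*} [CommRing R] [Nontrivial R] {M i u k : ℕ} {p : R[X]}
    (hrel : Polynomial.Chebyshev.C R (M : ℤ) = Polynomial.Chebyshev.C R (i : ℤ) + Polynomial.Chebyshev.S R (u : ℤ) * p) (hdeg : p.natDegree + u ≤ M) (hk : M = i + k) :
    (Polynomial.Chebyshev.C R (M : ℤ)).resultant (Polynomial.Chebyshev.S R (u : ℤ)) M u =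
      (-1) ^ (u * k) * (Polynomial.Chebyshev.C R (i : ℤ)).resultant (Polynomial.Chebyshev.S R (u : ℤ)) i u := by
  obtain ⟨hdegS, hmonic⟩ := chebyshevS_natDegree_monic (R := R) u
  have hcoeff : (Polynomial.Chebyshev.S R (u : ℤ)).coeff u = 1 := by
    have h := hmonic.coeff_natDegree
    rwa [hdegS] at h
  have hf : (Polynomial.Chebyshev.C R (i : ℤ)).natDegree ≤ i := chebyshevC_natDegree_le i
  rw [hrel, Polynomial.resultant_add_mul_left _ _ _ _ _ hdeg hdegS.le, hk, Polynomial.resultant_add_left_deg _ _ _ _ _ hf, hcoeff, one_pow, mul_one]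

/-- **`S`-SHIFT: `Res_{(m+1, j+2(m+1))}(C_{m+1}, S_{j+2(m+1)}) = (−1)^{m+1} Res_{(m+1,j)}(C_{m+1}, S_j)`** (from `C_M S_{j+M} = S_{j+2M} + S_j`). [this file, §1247] -/
theorem chebyshevCS_resultant_S_add_two_mul {R : Type*} [CommRing R] [Nontrivial R] (m j : ℕ) :
    (Polynomial.Chebyshev.C R ((m + 1 : ℕ) : ℤ)).resultant (Polynomial.Chebyshev.S R ((j + 2 * (m + 1) : ℕ) : ℤ)) (m + 1) (j + 2 * (m + 1)) =
      (-1) ^ (m + 1) * (Polynomial.Chebyshev.C R ((m + 1 : ℕ) : ℤ)).resultant (Polynomial.Chebyshev.S R (j : ℤ)) (m + 1) j := by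
  refine chebyshevCS_resultant_of_S_rel (i := j + (m + 1)) (k := 2 * (m + 1)) (ε := -1) ?_ (by omega) rfl
  have h := chebyshevC_mul_S (R := R) ((m + 1 : ℕ) : ℤ) ((j + (m + 1) : ℕ) : ℤ)
  rw [show ((j + (m + 1) : ℕ) : ℤ) + ((m + 1 : ℕ) : ℤ) = ((j + 2 * (m + 1) : ℕ) : ℤ) by push_cast; ring,
    show ((j + (m + 1) : ℕ) : ℤ) - ((m + 1 : ℕ) : ℤ) = (j : ℤ) by push_cast; ring] at h
  rw [C_neg, C_1]
  linear_combination (-1 : R[X]) * h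

/-- **`S`-REFLECTION: for `j + k + 1 = m`, `Res_{(m+1, k+(m+1))}(C_{m+1}, S_{k+(m+1)}) = Res_{(m+1,j)}(C_{m+1}, S_j)`** (from `C_M S_k = S_{k+M} − S_{M−k−2}`). [this file, §1247] -/
theorem chebyshevCS_resultant_S_reflect {R : Type*} [CommRing R] [Nontrivial R] {m j k : ℕ} (hjk : j + k + 1 = m) :
    (Polynomial.Chebyshev.C R ((m + 1 : ℕ) : ℤ)).resultant (Polynomial.Chebyshev.S R ((k + (m + 1) : ℕ) : ℤ)) (m + 1) (k + (m + 1)) =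
      (Polynomial.Chebyshev.C R ((m + 1 : ℕ) : ℤ)).resultant (Polynomial.Chebyshev.S R (j : ℤ)) (m + 1) j := by
  have h1 := chebyshevCS_resultant_of_S_rel (R := R) (m := m) (j := j) (i := k) (N := k + (m + 1)) (k := 2 * (k + 1)) (ε := 1) ?_ (by omega) (by omega)
  · rw [h1, one_pow, one_mul]
  have h := chebyshevC_mul_S (R := R) ((m + 1 : ℕ) : ℤ) (k : ℤ)
  rw [show (k : ℤ) + ((m + 1 : ℕ) : ℤ) = ((k + (m + 1) : ℕ) : ℤ) by push_cast; ring,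
    show (k : ℤ) - ((m + 1 : ℕ) : ℤ) = -((j : ℤ) + 2) by push_cast; omega, Polynomial.Chebyshev.S_neg, add_sub_cancel_right] at h
  rw [C_1]
  linear_combination (-1 : R[X]) * h

/-- `Res_{(m+1, 2m+1)}(C_{m+1}, S_{2m+1}) = 0` (`S_{2M−1} = C_M S_{M−1}`). [this file, §1247] -/
theorem chebyshevCS_resultant_S_two_mul_pred {R : Type*} [CommRing R] [Nontrivial R] (m : ℕ) :
    (Polynomial.Chebyshev.C R ((m + 1 : ℕ) : ℤ)).resultant (Polynomial.Chebyshev.S R ((2 * m + 1 : ℕ) : ℤ)) (m + 1) (2 * m + 1) = 0 := by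
  have hdegC := (Literature.Algebra.Polynomial.ChebyshevChains.monic_chebyshevC_and_natDegree (R := R) m).2
  have h := chebyshevC_mul_S (R := R) ((m + 1 : ℕ) : ℤ) (m : ℤ)
  rw [show (m : ℤ) + ((m + 1 : ℕ) : ℤ) = ((2 * m + 1 : ℕ) : ℤ) by push_cast; ring,
    show (m : ℤ) - ((m + 1 : ℕ) : ℤ) = -1 by push_cast; ring, Polynomial.Chebyshev.S_neg_one, add_zero] at h
  have hrel : Polynomial.Chebyshev.S R ((2 * m + 1 : ℕ) : ℤ) = 0 + Polynomial.Chebyshev.C R ((m + 1 : ℕ) : ℤ) * Polynomial.Chebyshev.S R (m : ℤ) := by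
    linear_combination (-1 : R[X]) * h
  have hp : (Polynomial.Chebyshev.S R (m : ℤ)).natDegree + (m + 1) ≤ 2 * m + 1 := by
    rw [(chebyshevS_natDegree_monic (R := R) m).1]; omega
  rw [hrel, Polynomial.resultant_add_mul_right _ _ _ _ _ hp hdegC.le, Polynomial.resultant_zero_right, zero_pow (Nat.succ_ne_zero m), zero_mul]

/-- **`C`-SHIFT: `Res_{(i+2(u+1), u)}(C_{i+2(u+1)}, S_u) = Res_{(i,u)}(C_i, S_u)`** (from `C_{i+2n} − C_i = (X²−4) S_{n−1} S_{i+n−1}`). [this file, §1247] -/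
theorem chebyshevCS_resultant_C_add_two_mul {R : Type*} [CommRing R] [Nontrivial R] (i u : ℕ) :
    (Polynomial.Chebyshev.C R ((i + 2 * (u + 1) : ℕ) : ℤ)).resultant (Polynomial.Chebyshev.S R (u : ℤ)) (i + 2 * (u + 1)) u =
      (Polynomial.Chebyshev.C R (i : ℤ)).resultant (Polynomial.Chebyshev.S R (u : ℤ)) i u := by
  have h := chebyshevC_add_sub_C_sub (R := R) ((u : ℤ) + 1) ((i : ℤ) + u + 1)
  rw [show (i : ℤ) + u + 1 + ((u : ℤ) + 1) = ((i + 2 * (u + 1) : ℕ) : ℤ) by push_cast; ring, show (i : ℤ) + u + 1 - ((u : ℤ) + 1) = (i : ℤ) by ring,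
    add_sub_cancel_right, show (i : ℤ) + u + 1 - 1 = ((i + u : ℕ) : ℤ) by push_cast; ring] at h
  have hrel : Polynomial.Chebyshev.C R ((i + 2 * (u + 1) : ℕ) : ℤ) =
      Polynomial.Chebyshev.C R (i : ℤ) + Polynomial.Chebyshev.S R (u : ℤ) * ((Polynomial.X ^ 2 - 4) * Polynomial.Chebyshev.S R ((i + u : ℕ) : ℤ)) := by
    linear_combination h
  have hp : ((Polynomial.X ^ 2 - 4) * Polynomial.Chebyshev.S R ((i + u : ℕ) : ℤ) : R[X]).natDegree + u ≤ i + 2 * (u + 1) := by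
    have h2 : (Polynomial.X ^ 2 - 4 : R[X]).natDegree ≤ 2 :=
      (Polynomial.natDegree_sub_le _ _).trans (by rw [natDegree_X_pow, show (4 : R[X]) = Polynomial.C 4 from (Polynomial.C_ofNat 4).symm, natDegree_C]; omega)
    have h3 := Polynomial.natDegree_mul_le (p := (Polynomial.X ^ 2 - 4 : R[X])) (q := Polynomial.Chebyshev.S R ((i + u : ℕ) : ℤ))
    rw [(chebyshevS_natDegree_monic (R := R) (i + u)).1] at h3
    omega
  rw [chebyshevCS_resultant_of_C_rel hrel hp rfl, show u * (2 * (u + 1)) = 2 * (u * (u + 1)) by ring, pow_mul, neg_one_sq, one_pow, one_mul]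

/-- **`C`-REFLECTION: for `i + k = u + 1`, `k ≥ 1`, `Res_{(k+(u+1), u)}(C_{k+(u+1)}, S_u) = Res_{(i,u)}(C_i, S_u)`** (from `C_{k+n} − C_{n−k} = (X²−4) S_{n−1} S_{k−1}`). [this file, §1247] -/
theorem chebyshevCS_resultant_C_reflect {R : Type*} [CommRing R] [Nontrivial R] {i u k : ℕ} (hik : i + k = u + 1) (hk : 1 ≤ k) :
    (Polynomial.Chebyshev.C R ((k + (u + 1) : ℕ) : ℤ)).resultant (Polynomial.Chebyshev.S R (u : ℤ)) (k + (u + 1)) u =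
      (Polynomial.Chebyshev.C R (i : ℤ)).resultant (Polynomial.Chebyshev.S R (u : ℤ)) i u := by
  obtain ⟨k', rfl⟩ : ∃ k', k = k' + 1 := ⟨k - 1, by omega⟩
  have h := chebyshevC_add_sub_C_sub (R := R) ((u : ℤ) + 1) ((k' : ℤ) + 1)
  rw [show (k' : ℤ) + 1 + ((u : ℤ) + 1) = ((k' + 1 + (u + 1) : ℕ) : ℤ) by push_cast; ring, show (k' : ℤ) + 1 - ((u : ℤ) + 1) = -(i : ℤ) by omega,
    Polynomial.Chebyshev.C_neg, add_sub_cancel_right, add_sub_cancel_right] at h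
  have hrel : Polynomial.Chebyshev.C R ((k' + 1 + (u + 1) : ℕ) : ℤ) =
      Polynomial.Chebyshev.C R (i : ℤ) + Polynomial.Chebyshev.S R (u : ℤ) * ((Polynomial.X ^ 2 - 4) * Polynomial.Chebyshev.S R (k' : ℤ)) := by
    linear_combination h
  have hp : ((Polynomial.X ^ 2 - 4) * Polynomial.Chebyshev.S R (k' : ℤ) : R[X]).natDegree + u ≤ k' + 1 + (u + 1) := by
    have h2 : (Polynomial.X ^ 2 - 4 : R[X]).natDegree ≤ 2 :=
      (Polynomial.natDegree_sub_le _ _).trans (by rw [natDegree_X_pow, show (4 : R[X]) = Polynomial.C 4 from (Polynomial.C_ofNat 4).symm, natDegree_C]; omega)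
    have h3 := Polynomial.natDegree_mul_le (p := (Polynomial.X ^ 2 - 4 : R[X])) (q := Polynomial.Chebyshev.S R (k' : ℤ))
    rw [(chebyshevS_natDegree_monic (R := R) k').1] at h3
    omega
  rw [chebyshevCS_resultant_of_C_rel hrel hp (show k' + 1 + (u + 1) = i + 2 * (k' + 1) by omega), show u * (2 * (k' + 1)) = 2 * (u * (k' + 1)) by ring, pow_mul,
    neg_one_sq, one_pow, one_mul]

/-- **Consecutive value: `Res_{(n+1, n)}(C_{n+1}, S_n) = 2^n (−1)^{n(n+1)∕2}`** (`C_{n+1} = 2 S_{n+1} − X S_n` and Schur for `S`, N468). [this file, §1247] -/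
theorem chebyshevCS_resultant_succ_pred {R : Type*} [CommRing R] (n : ℕ) :
    (Polynomial.Chebyshev.C R ((n + 1 : ℕ) : ℤ)).resultant (Polynomial.Chebyshev.S R (n : ℤ)) (n + 1) n = 2 ^ n * (-1) ^ (n * (n + 1) / 2) := by
  nontriviality R
  have hrel : Polynomial.Chebyshev.C R ((n + 1 : ℕ) : ℤ) = Polynomial.C 2 * Polynomial.Chebyshev.S R (((n + 1 : ℕ)) : ℤ) + Polynomial.Chebyshev.S R (n : ℤ) * (-Polynomial.X) := by
    rw [Polynomial.Chebyshev.C_eq_S_sub_X_mul_S, show (((n + 1 : ℕ)) : ℤ) - 1 = (n : ℤ) by push_cast; ring, show (Polynomial.C 2 : R[X]) = 2 from Polynomial.C_ofNat 2]; ring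
  have hp : (-Polynomial.X : R[X]).natDegree + n ≤ n + 1 := by rw [natDegree_neg]; have := natDegree_X_le (R := R); omega
  rw [hrel, Polynomial.resultant_add_mul_left _ _ _ _ _ hp (chebyshevS_natDegree_monic (R := R) n).1.le, Polynomial.resultant_C_mul_left, chebyshevS_resultant_succ]

/-- **`Res_{(m,n)}(C_m, S_n) = 0` if `(n+1) ∕ gcd(m, n+1)` is even, and `= (−1)^{mn∕2} · 2^{gcd(m,n+1) − 1}` otherwise, for all `m, n ∈ ℕ` and EVERY commutative ring** (monic mixed pair).
[Dilcher–Stolarsky 2005 §3–§4 (monic form); this file, §1247] -/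
theorem chebyshevCS_resultant_closed {R : Type*} [CommRing R] (m n : ℕ) :
    (Polynomial.Chebyshev.C R (m : ℤ)).resultant (Polynomial.Chebyshev.S R (n : ℤ)) m n =
      if Even ((n + 1) / Nat.gcd m (n + 1)) then 0 else (-1) ^ (m * n / 2) * 2 ^ (Nat.gcd m (n + 1) - 1) := by
  nontriviality R
  obtain ⟨s, hs⟩ : ∃ s, m + n = s := ⟨_, rfl⟩
  induction s using Nat.strong_induction_on generalizing m n with
  | _ s ih =>
  rcases Nat.eq_zero_or_pos m with rfl | hm
  · -- `C_0 = 2`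
    rw [Nat.cast_zero, Polynomial.Chebyshev.C_zero, show (2 : R[X]) = Polynomial.C 2 from (Polynomial.C_ofNat 2).symm, Polynomial.resultant_C_zero_left, Nat.gcd_zero_left,
      Nat.div_self (Nat.succ_pos n), if_neg Nat.not_even_one, zero_mul, Nat.zero_div, pow_zero, one_mul, Nat.add_sub_cancel]
  obtain ⟨m, rfl⟩ : ∃ m', m = m' + 1 := ⟨m - 1, by omega⟩
  rcases Nat.lt_or_ge m n with hmn | hmn
  · rcases Nat.lt_or_ge n (2 * m + 1) with h2 | h2
    · -- `S`-reflection
      obtain ⟨k, j, rfl, hjk⟩ : ∃ k j, n = k + (m + 1) ∧ j + k + 1 = m := ⟨n - (m + 1), 2 * m - n, by omega, by omega⟩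
      subst hjk
      obtain ⟨hg, hodd⟩ := gcd_eq_and_odd_div_iff_of_add_eq (m := j + k + 1 + 1) (n := k + (j + k + 1 + 1) + 1) (j := j + 1) (q := 1) (by ring)
      rw [chebyshevCS_resultant_S_reflect rfl, ih (j + k + 1 + 1 + j) (by omega) (j + k + 1 + 1) j rfl, hg]
      by_cases hP : Even ((j + 1) / Nat.gcd (j + k + 1 + 1) (j + 1))
      · rw [if_pos hP, if_pos (by rw [← Nat.not_odd_iff_even, hodd, Nat.not_odd_iff_even]; exact hP)]
      · have hP' : ¬ Even ((k + (j + k + 1 + 1) + 1) / Nat.gcd (j + k + 1 + 1) (j + 1)) := by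
          rw [← Nat.not_odd_iff_even, hodd, Nat.not_odd_iff_even]; exact hP
        rw [if_neg hP, if_neg hP']
        have hev : Even ((j + k + 1 + 1) * (k + (j + k + 1 + 1))) := even_mul_of_not_even_div (hg.symm ▸ hP')
        have hk1 : Even ((j + k + 1 + 1) * (k + 1)) := by
          rcases Nat.even_or_odd (j + k + 1 + 1) with he | ho
          · exact he.mul_right _
          · have hu : Even (k + (j + k + 1 + 1)) := (Nat.even_mul.1 hev).resolve_left (Nat.not_even_iff_odd.2 ho)
            have hk : Odd k := by
              rcases Nat.even_or_odd k with hk | hk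
              · exact absurd (by simpa [Nat.even_add, hk] using hu) (Nat.not_even_iff_odd.2 ho)
              · exact hk
            exact (hk.add_one).mul_left _
        have hdiv : (j + k + 1 + 1) * (k + (j + k + 1 + 1)) / 2 = (j + k + 1 + 1) * j / 2 + (j + k + 1 + 1) * (k + 1) := by
          rw [show (j + k + 1 + 1) * (k + (j + k + 1 + 1)) = (j + k + 1 + 1) * j + 2 * ((j + k + 1 + 1) * (k + 1)) by ring,
            Nat.add_mul_div_left _ _ (by norm_num : 0 < 2)]
        rw [hdiv, pow_add (-1 : R) ((j + k + 1 + 1) * j / 2) ((j + k + 1 + 1) * (k + 1)), Even.neg_one_pow hk1, mul_one]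
    · rcases Nat.eq_or_lt_of_le h2 with h3 | h3
      · subst h3
        rw [chebyshevCS_resultant_S_two_mul_pred, show 2 * m + 1 + 1 = (m + 1) * 2 by ring, Nat.gcd_mul_right_right, Nat.mul_div_cancel_left 2 (Nat.succ_pos m), if_pos even_two]
      · -- `S`-shift
        obtain ⟨j, rfl⟩ : ∃ j, n = j + 2 * (m + 1) := ⟨n - 2 * (m + 1), by omega⟩
        obtain ⟨hg, hodd⟩ := gcd_eq_and_odd_div_iff_of_eq_add (m := m + 1) (n := j + 2 * (m + 1) + 1) (j := j + 1) (q := 1) (by ring)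
        rw [chebyshevCS_resultant_S_add_two_mul, ih (m + 1 + j) (by omega) (m + 1) j rfl, hg]
        by_cases hP : Even ((j + 1) / Nat.gcd (m + 1) (j + 1))
        · rw [if_pos hP, if_pos (by rw [← Nat.not_odd_iff_even, hodd, Nat.not_odd_iff_even]; exact hP), mul_zero]
        · have hP' : ¬ Even ((j + 2 * (m + 1) + 1) / Nat.gcd (m + 1) (j + 1)) := by
            rw [← Nat.not_odd_iff_even, hodd, Nat.not_odd_iff_even]; exact hP
          rw [if_neg hP, if_neg hP']
          have hdiv : (m + 1) * (j + 2 * (m + 1)) / 2 = (m + 1) * j / 2 + (m + 1) * (m + 1) := by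
            rw [show (m + 1) * (j + 2 * (m + 1)) = (m + 1) * j + 2 * ((m + 1) * (m + 1)) by ring, Nat.add_mul_div_left _ _ (by norm_num : 0 < 2)]
          have hsgn : ((-1 : R)) ^ ((m + 1) * (m + 1)) = (-1) ^ (m + 1) := by
            rcases Nat.even_or_odd (m + 1) with h | h
            · rw [Even.neg_one_pow h, Even.neg_one_pow (h.mul_right _)]
            · rw [Odd.neg_one_pow h, Odd.neg_one_pow (h.mul h)]
          rw [hdiv, pow_add (-1 : R) ((m + 1) * j / 2) ((m + 1) * (m + 1)), hsgn]
          ring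
  · rcases Nat.eq_or_lt_of_le hmn with h3 | hnm
    · -- `n = m`: the consecutive pair
      subst h3
      rw [chebyshevCS_resultant_succ_pred, Nat.gcd_self, Nat.div_self (Nat.succ_pos n), if_neg Nat.not_even_one, mul_comm (n + 1) n, Nat.add_sub_cancel, mul_comm]
    · rcases Nat.lt_or_ge (m + 1) (2 * (n + 1)) with h2 | h2
      · -- `C`-reflection
        obtain ⟨k, i, hmk, hik⟩ : ∃ k i, m + 1 = k + (n + 1) ∧ i + k = n + 1 := ⟨m - n, 2 * n + 1 - m, by omega, by omega⟩
        obtain ⟨hg, -⟩ := gcd_eq_and_odd_div_iff_of_add_eq (m := n + 1) (n := k + (n + 1)) (j := i) (q := 1) (by omega)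
        rw [Nat.gcd_comm (n + 1) (k + (n + 1)), Nat.gcd_comm (n + 1) i] at hg
        have hcast : ((m + 1 : ℕ) : ℤ) = ((k + (n + 1) : ℕ) : ℤ) := by rw [hmk]
        rw [hcast, hmk, chebyshevCS_resultant_C_reflect hik (by omega), ih (i + n) (by omega) i n rfl, hg]
        by_cases hP : Even ((n + 1) / Nat.gcd i (n + 1))
        · rw [if_pos hP, if_pos hP]
        · rw [if_neg hP, if_neg hP]
          have hkn : Even (k * n) := by
            rcases Nat.even_or_odd n with hn | hn
            · exact hn.mul_left _
            · have hge : Even (Nat.gcd i (n + 1)) := by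
                by_contra hg'
                have hprod : Even (Nat.gcd i (n + 1) * ((n + 1) / Nat.gcd i (n + 1))) := by
                  rw [Nat.mul_div_cancel' (Nat.gcd_dvd_right i (n + 1))]; exact hn.add_one
                exact hP ((Nat.even_mul.1 hprod).resolve_left hg')
              have hMe : Even (k + (n + 1)) := by
                have hd : Nat.gcd (k + (n + 1)) (n + 1) ∣ k + (n + 1) := Nat.gcd_dvd_left _ _
                rw [hg] at hd
                exact even_iff_two_dvd.2 ((even_iff_two_dvd.1 hge).trans hd)
              have hke : Even k := by
                rcases Nat.even_or_odd k with hk | hk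
                · exact hk
                · exact absurd hMe (Nat.not_even_iff_odd.2 (hk.add_even hn.add_one))
              exact hke.mul_right _
          have hdiv : (k + (n + 1)) * n / 2 = i * n / 2 + k * n := by
            rw [show (k + (n + 1)) * n = i * n + 2 * (k * n) by nlinarith [hik], Nat.add_mul_div_left _ _ (by norm_num : 0 < 2)]
          rw [hdiv, pow_add (-1 : R) (i * n / 2) (k * n), Even.neg_one_pow hkn, mul_one]
      · -- `C`-shift
        obtain ⟨i, hmi⟩ : ∃ i, m + 1 = i + 2 * (n + 1) := ⟨m + 1 - 2 * (n + 1), by omega⟩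
        obtain ⟨hg, -⟩ := gcd_eq_and_odd_div_iff_of_eq_add (m := n + 1) (n := i + 2 * (n + 1)) (j := i) (q := 1) (by ring)
        rw [Nat.gcd_comm (n + 1) (i + 2 * (n + 1)), Nat.gcd_comm (n + 1) i] at hg
        have hcast : ((m + 1 : ℕ) : ℤ) = ((i + 2 * (n + 1) : ℕ) : ℤ) := by rw [hmi]
        rw [hcast, hmi, chebyshevCS_resultant_C_add_two_mul, ih (i + n) (by omega) i n rfl, hg]
        by_cases hP : Even ((n + 1) / Nat.gcd i (n + 1))
        · rw [if_pos hP, if_pos hP]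
        · rw [if_neg hP, if_neg hP]
          have hdiv : (i + 2 * (n + 1)) * n / 2 = i * n / 2 + n * (n + 1) := by
            rw [show (i + 2 * (n + 1)) * n = i * n + 2 * (n * (n + 1)) by ring, Nat.add_mul_div_left _ _ (by norm_num : 0 < 2)]
          rw [hdiv, pow_add (-1 : R) (i * n / 2) (n * (n + 1)), Even.neg_one_pow (Nat.even_mul_succ_self n), mul_one]

end Summit.Ventures.HSemireg.Wedge.HankelOuter
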